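import Literature.NumberTheory.EllipticCurves.H1CorestrictionIndexTwo
import Literature.NumberTheory.EllipticCurves.H1UnramifiedFinite
import HarnessLib

/-!
# `2·[f] = 0` for a continuous `1`-cocycle centralised, up to its value, by an element acting as `−1`

Crux `stmt-BirchSwinnertonDyer-20368` (`PrintCf2.SplitBadTwoRankOneOfFacts`), road α, LEAD ruling (R-ET) 2026-08-29: the
hfin-FREE local brick (ET-v) «`2 • res_{D_v}(e_* κ_n(Q)) = 0`» (hypothesis `hET` of -w3 g10
`CMPrimes.cmScalar_localPoints_of_frame_of_etale`, p682736). This file is its GROUP-COHOMOLOGICAL core, generic and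
self-contained (no number theory): for a topological group `G`, a discrete `G`-module `M`, a continuous crossed homomorphism
`f : G → M` and an element `c ∈ G` acting on `M` as `−1` such that `f(σ c σ⁻¹) = f(c)` for every `σ ∈ G`, one has the
identity `2·f(σ) = f(c) − σ·f(c)` — so `2f` is the coboundary of `−f(c)` and `2·[f] = 0` in `H¹_cont(G, M)`.
(At the place `v` of road α: `G = D_v`, `M = W* = E[𝔮_r^∞]` the CM summand pinned at `v`, `c` an inertia element negating
`√d` — it acts on `W*` as `−1` —, `f` the `W*`-component of a Kummer cocycle; the hypothesis `f(σcσ⁻¹) = f(c)` is Greenberg's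
«a Kummer cocycle of the good twist takes values in the kernel-of-reduction line on the inertia of `K_v(√d)`», LNM 1716 §2.)
No definition, no named fact, no `sorry`. BSD is not proved by any of this.

References: [SerreGaloisCohomology1997] J.-P. Serre, *Galois Cohomology*, I.§2.2, I.§5.1 (crossed homomorphisms, principal
ones); [GreenbergLNM1716] R. Greenberg, LNM 1716 (1999), §2 Props. 2.1–2.4.
-/

noncomputable section

universe u

set_option linter.dupNamespace false

namespace Summit.BirchSwinnertonDyer.BirchSwinnertonDyer.Theorems.PrintCf2.CMPrimes

open Literature.NumberTheory.EllipticCurves Literature.NumberTheory.GaloisRepresentations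

variable {G : Type u} [Group G] [TopologicalSpace G] [IsTopologicalGroup G]
  {M : Type u} [AddCommGroup M] [DistribMulAction G M] [TopologicalSpace M] [DiscreteTopology M]

omit [IsTopologicalGroup G] in
/-- A crossed homomorphism vanishes at `1`. Serre, *Galois Cohomology*, I.§5.1. [folklore] -/
theorem contOneCocycles_apply_one (f : contOneCocycles (discreteTopRep G M)) : f.1 1 = 0 := by
  have h := cocycle_mul' f 1 1
  rw [mul_one, one_smul] at h
  have h' : f.1 1 + f.1 1 = f.1 1 + 0 := by rw [add_zero]; exact h.symm
  exact add_left_cancel h'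

omit [IsTopologicalGroup G] in
/-- `f(σ⁻¹) = −σ⁻¹·f(σ)` for a crossed homomorphism. Serre, *Galois Cohomology*, I.§5.1. [folklore] -/
theorem contOneCocycles_apply_inv (f : contOneCocycles (discreteTopRep G M)) (σ : G) :
    f.1 σ⁻¹ = -(σ⁻¹ • f.1 σ) := by
  have h := cocycle_mul' f σ⁻¹ σ
  rw [inv_mul_cancel, contOneCocycles_apply_one] at h
  exact eq_neg_of_add_eq_zero_left h.symm

omit [IsTopologicalGroup G] in
/-- **The value identity.** If `c` acts on `M` as `−1` and `f(σ c σ⁻¹) = f(c)`, then `2·f(σ) = f(c) − σ·f(c)`: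
expand `f(σcσ⁻¹) = f(σ) + σ·f(c) + σc·f(σ⁻¹)` and use `σc·f(σ⁻¹) = −σcσ⁻¹·f(σ) = f(σ)`.
[cite: SerreGaloisCohomology1997, I.§5.1] -/
theorem two_nsmul_apply_eq_of_conj (f : contOneCocycles (discreteTopRep G M)) {c : G}
    (hc : ∀ m : M, c • m = -m) {σ : G} (h : f.1 (σ * c * σ⁻¹) = f.1 c) :
    2 • f.1 σ = f.1 c - σ • f.1 c := by
  have key : f.1 (σ * c * σ⁻¹) = 2 • f.1 σ + σ • f.1 c := by
    rw [cocycle_mul' f (σ * c) σ⁻¹, cocycle_mul' f σ c, contOneCocycles_apply_inv, smul_neg, mul_smul, hc,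
      smul_neg, neg_neg, smul_inv_smul, two_nsmul]
    abel
  rw [key] at h
  exact eq_sub_of_add_eq h

/-- **`2·[f] = 0`.** Under the same hypotheses (for every `σ`), `2f` is the coboundary of `−f(c)`, so the class of `f` in
`H¹_cont(G, M)` is killed by `2`. [cite: SerreGaloisCohomology1997, I.§2.2 and I.§5.1] -/
theorem two_nsmul_oneCocycleClass_eq_zero_of_conj (f : contOneCocycles (discreteTopRep G M)) {c : G}
    (hc : ∀ m : M, c • m = -m) (h : ∀ σ : G, f.1 (σ * c * σ⁻¹) = f.1 c) :
    2 • oneCocycleClass (discreteTopRep G M) f = 0 := by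
  rw [← classHom_apply, ← map_nsmul, classHom_apply, oneCocycleClass_eq_zero_iff]
  refine ⟨-f.1 c, fun σ ↦ ?_⟩
  have h2 : (2 • f).1 σ = 2 • f.1 σ := by
    rw [two_nsmul, two_nsmul, Submodule.coe_add, ContinuousMap.add_apply]
  rw [h2, two_nsmul_apply_eq_of_conj f hc (h σ)]
  change f.1 c - σ • f.1 c = σ • (-f.1 c) - -f.1 c
  rw [smul_neg, sub_neg_eq_add]
  abel

/-- Class-level variant with the hypothesis on SOME representative: if `η = [f]` with `f` as above then `2 • η = 0`.
[cite: SerreGaloisCohomology1997, I.§2.2 and I.§5.1] -/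
theorem two_nsmul_eq_zero_of_exists_conj {η : discreteH1 G M} {c : G} (hc : ∀ m : M, c • m = -m)
    (h : ∃ f : contOneCocycles (discreteTopRep G M), oneCocycleClass (discreteTopRep G M) f = η ∧
      ∀ σ : G, f.1 (σ * c * σ⁻¹) = f.1 c) :
    2 • η = 0 := by
  obtain ⟨f, rfl, hf⟩ := h
  exact two_nsmul_oneCocycleClass_eq_zero_of_conj f hc hf

end Summit.BirchSwinnertonDyer.BirchSwinnertonDyer.Theorems.PrintCf2.CMPrimes

end
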